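import Summits.ResolutionOfSingularities.ResolutionOfSingularities.Theorems.EquisingularLiftEquisingularLiftNatCentredPointStepExact
import Summits.ResolutionOfSingularities.ResolutionOfSingularities.Theorems.EquisingularLiftEquisingularLiftNatStrictTransformComap
import Summits.ResolutionOfSingularities.ResolutionOfSingularities.Theorems.EquisingularLiftEquisingularLiftNatCentredStepRegular
import Summits.ResolutionOfSingularities.ResolutionOfSingularities.Theorems.EquisingularLiftEquisingularLiftNatInCarrierStepFlat
import Summits.ResolutionOfSingularities.ResolutionOfSingularities.Theorems.EquisingularLiftEquisingularLiftNatCarrierPairStrictTransformRegular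
import Summits.ResolutionOfSingularities.ResolutionOfSingularities.Theorems.EquisingularLiftEquisingularLiftNatStrictTransformOffCentre
import Summits.ResolutionOfSingularities.ResolutionOfSingularities.Theorems.EquisingularLiftEquisingularLiftNatStrictTransformSupport
import Summits.ResolutionOfSingularities.ResolutionOfSingularities.Theorems.EquisingularLiftEquisingularLiftNatModelPointStepOfSection
import Summits.ResolutionOfSingularities.ResolutionOfSingularities.Theorems.EquisingularLiftEquisingularLiftNatStalkDimension
import Summits.ResolutionOfSingularities.ResolutionOfSingularities.Theorems.EquisingularLiftEquisingularLiftNatCarrierDeltaSectionFrameDim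
import Summits.ResolutionOfSingularities.ResolutionOfSingularities.Theorems.EquisingularLiftEquisingularLiftChainRegular
import Literature.AlgebraicGeometry.Resolution.BlowupsExistence
import HarnessLib

/-!
# [OURS · L1 W4.5(b) · EL♮(3)] HSUB(ReachTC⁺)₃ — brick (C) `inv_step_singular`: the step of the invariant `TCPlus.Inv` at the
# NON-REGULAR point of the running curve (registered stub `stub_elnat_tcPlusPointResolution`; driver
# `hsub_reachTCPlus_of_invariant` p526242, INV DEFS v3 …NatSubchainSupplierInvDefs p532383)

Crux `EquisingularLiftNat` = stmt-ResolutionOfSingularities-20038 (child EL♮(3) = stmt-ResolutionOfSingularities-20148), route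
EquisingularLift, line `sections`. Helper file `--supports stmt-ResolutionOfSingularities-20148 --as helper` by res-L1-w45b-stub-1
(HSUB(ReachTC⁺)₃ assembly holder). HONEST FRAMING: OURS (cell res-hironaka, slot W4.5(b)); NOT a statement of any manuscript;
AI-written, weaker than expert review. No `sorry`; standard axioms.

WHAT. The third hypothesis «(step, flag raised)» of the driver for `INV := TCPlus.Inv O k θ P q Y Ch` at `n = 3`: from
`Inv W G₁ β T Z false`, a CLOSED NON-REGULAR point `y` of the reduced curve `V(closure Z)_red` lying on `T`, and the blow-up
`υ₁ : G₂ → G₁` of the reduced point, produce `Inv W G₂ (υ₁ ≫ β) (closure υ₁⁻¹(T ∖ {y})) (closure υ₁⁻¹(Z ∖ {y})) true`.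

HOW (pure assembly of landed bricks). The flag clause of `Inv` gives a member CENTRED at `y` (`excl = {y}`), whose clause (vi) is a
`TCPlus.CentredPackage` at `p = jG y`: a section `s` through `p` on the in-carrier surface, a frame `c` of `(ker s)_p` with `c₀` the
carrier equation, the cone `K_p = (Φ(c₁, c₂))` of order `m`, exact at the special point, and `ConeDeltaRegular c Φ`. Blow `X` up along
`ker s` (`exists_isBlowup`); res-D-pv-029's `modelPointStep_of_section` (p526229) realises `υ₁` as its special fibre with the new model
square and the new `Ch`-stage. The new member is `(St 𝓢, St K)` with `excl = ∅`:
(i) exactness = F⁺5 `comap_strictTransformIdeal_eq_of_model` (p519966) for `𝓢` (linear form `T₀`) and for `K` (the form `Φ` renamed to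
the frame variables) + res-D-pv-029's K7e `strictTransformIdeal_comap_sup_eq_vanishingIdeal_of_centredPackage` (p534965);
(ii) flatness = res-L1-w45b-stub-2's K7b `flat_carrierStrictTransform_subschemeι_comp_stage` (p532002) with the package frame
(`(c) + (ϖ) = 𝔪_p` from res-type-100's section frame, `dim 𝒪_{X,p} = 3 + 1` by T-DIM);
(iii) = K7d `member_clause_iii_strictTransform_section` (p529806);
(iv) `supp St ⊆ τ⁻¹ supp`;
(v) over `p` = res-D-pv-029's (n1) `isRegularLocalRing_quotient_carrierStrictTransform_of_coneDeltaRegular` (p536122), off `p` =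
…NatStrictTransformOffCentre (p538787) + the old member's (v);
(vi) vacuous. At the `Inv` level: `G₂` integral and the new `T` irreducible (model step), and `T₂ ⊄ closure Z₂` because `υ₁` is onto
off `y` (`Split.existsUnique_preimage`).

References: [cite: GortzWedhorn2020, Prop. 13.91, Prop. 13.96]; [cite: Liu2002, §8.1, Thm. 8.1.19]; [cite: Matsumura1987, Thm. 16.2].
Tree inputs as listed (p-ids above).
-/

set_option linter.dupNamespace false -- mandated namespace `Summit.<Summit>.<Problem>` of this single-conjunct summit
set_option linter.overlappingInstances false -- signatures carry `[IsDomain O] [IsDiscreteValuationRing O]`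

noncomputable section

open CategoryTheory CategoryTheory.Limits AlgebraicGeometry TopologicalSpace Topology IsLocalRing
open Literature.AlgebraicGeometry.Resolution
open AlgebraicGeometry.Scheme.IdealSheafData
open Summit.ResolutionOfSingularities.ResolutionOfSingularities.Theses.EquisingularLift.Split
open Summit.ResolutionOfSingularities.ResolutionOfSingularities.Cruxes.EquisingularLift.StrataSplit

namespace Summit.ResolutionOfSingularities.ResolutionOfSingularities.Cruxes.EquisingularLiftNat.Sections

/-! ## 0. Point-generalised forms of two bricks (the frame may live at any point equal to the stepped one) -/

/-- res-L1-w45b-stub-2's K7b `flat_carrierStrictTransform_subschemeι_comp_stage` with the frame placed at a point `p` that is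
only propositionally `s(𝔪_O)`. [OURS · L1 W4.5b] -/
theorem flat_carrierStrictTransform_subschemeι_comp_at (O : Type) [CommRing O] [IsDomain O] [IsDiscreteValuationRing O]
    {X X' P : Scheme.{0}} (σ : X ⟶ P) (q : P ⟶ Spec (.of O)) [IsSeparated (σ ≫ q)]
    (s : Spec (.of O) ⟶ X) (hs : s ≫ σ ≫ q = 𝟙 _) (τ : X' ⟶ X) (hτ : IsBlowup τ s.ker)
    [IsLocallyNoetherian X] [IsLocallyNoetherian X']
    (𝓢 K : X.IdealSheafData) (hflat : Flat ((𝓢 ⊔ K).subschemeι ≫ σ ≫ q))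
    (p : X) (hp : s (closedPoint O) = p)
    {n : ℕ} (c : Fin (n + 1) → X.presheaf.stalk p) (hcJ : Ideal.span (Set.range c) = stalkIdeal s.ker p)
    (h𝓢 : stalkIdeal 𝓢 p = Ideal.span {c 0})
    {m : ℕ} (Φ : MvPolynomial (Fin n) (X.presheaf.stalk p)) (hΦd : Φ.IsHomogeneous m)
    (hK : stalkIdeal K p = Ideal.span {MvPolynomial.eval (fun l => c l.succ) Φ})
    (ϖ : O) (hϖ : Irreducible ϖ)
    (h𝔪 : Ideal.span (Set.range c) ⊔ Ideal.span {(X.presheaf.Γgerm p).hom ((σ ≫ q).appTop.hom ((Scheme.ΓSpecIso (.of O)).inv.hom ϖ))} =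
      maximalIdeal (X.presheaf.stalk p))
    (hdim : ringKrullDim (X.presheaf.stalk p) = (n + 2 : ℕ))
    (hΦ𝔪 : MvPolynomial.map (residue (X.presheaf.stalk p)) Φ ≠ 0) :
    Flat ((strictTransformIdeal τ s.ker 𝓢 ⊔ strictTransformIdeal τ s.ker K).subschemeι ≫ (τ ≫ σ) ≫ q) := by
  subst hp
  exact flat_carrierStrictTransform_subschemeι_comp_stage O σ q s hs τ hτ 𝓢 K hflat c hcJ h𝓢 Φ hΦd hK ϖ hϖ h𝔪 hdim hΦ𝔪

/-- res-D-pv-029's (n1) `isRegularLocalRing_quotient_carrierStrictTransform_of_coneDeltaRegular` with the frame placed at a point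
`p` that is only propositionally `τ x'`. [OURS · L1 W4.5b] -/
theorem isRegularLocalRing_quotient_carrierStrictTransform_of_coneDeltaRegular_at {X X' : Scheme.{0}} {τ : X' ⟶ X}
    {J : X.IdealSheafData} [IsLocallyNoetherian X'] (hτ : IsBlowup τ J)
    (𝓢 K : X.IdealSheafData) (p : X) (x' : X') (hx : τ x' = p) (hp : p ∈ (J.support : Set X)) {r : ℕ}
    (c : Fin (r + 1) → X.presheaf.stalk p) (hcJ : Ideal.span (Set.range c) = stalkIdeal J p)
    (hc : IsQuasiRegular c) [IsDomain (X.presheaf.stalk p ⧸ Ideal.span (Set.range c))]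
    (hcb : IsQuasiRegular fun l : Fin r => Ideal.Quotient.mk (Ideal.span {c 0}) (c l.succ))
    (h𝓢 : stalkIdeal 𝓢 p = Ideal.span {c 0})
    {d : ℕ} (Φ : MvPolynomial (Fin r) (X.presheaf.stalk p)) (hΦd : Φ.IsHomogeneous d)
    (hΦ : MvPolynomial.map (Ideal.Quotient.mk (Ideal.span (Set.range c))) Φ ≠ 0)
    (hK : stalkIdeal K p = Ideal.span {MvPolynomial.eval (fun l => c l.succ) Φ})
    (hx'D : x' ∈ ((strictTransformIdeal τ J 𝓢 ⊔ strictTransformIdeal τ J K).support : Set X'))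
    (hΔ : TCPlus.ConeDeltaRegular c Φ) :
    IsRegularLocalRing (X'.presheaf.stalk x' ⧸ stalkIdeal (strictTransformIdeal τ J 𝓢 ⊔ strictTransformIdeal τ J K) x') ∧
      ringKrullDim (X'.presheaf.stalk x' ⧸ stalkIdeal (strictTransformIdeal τ J 𝓢 ⊔ strictTransformIdeal τ J K) x') + 2 =
        ringKrullDim (X'.presheaf.stalk x') := by
  subst hx
  exact isRegularLocalRing_quotient_carrierStrictTransform_of_coneDeltaRegular hτ 𝓢 K x' hp c hcJ hc hcb h𝓢 Φ hΦd hΦ hK hx'D hΔ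

/-! ## 1. A blow-up of a point is onto off the point: the new `T` is not inside the new `closure Z` -/

/-- If `T ⊄ closure Z` and `x ∈ closure Z`, then after the blow-up `υ` of the reduced point `x` the strict transform
`closure υ⁻¹(T ∖ {x})` is not inside `closure (closure υ⁻¹(Z ∖ {x}))`. [folklore; GW Prop. 13.91 (3)] -/
theorem not_closure_preimage_diff_subset_of_isBlowup_point {G G₂ : Scheme.{0}} (υ : G₂ ⟶ G) {x : G}
    (hx : IsClosed ({x} : Set G)) (hυ : IsBlowup υ (vanishingIdeal ⟨{x}, hx⟩)) {T Z : Set G}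
    (hTZ : ¬ T ⊆ closure Z) (hxZ : x ∈ closure Z) :
    ¬ closure (υ ⁻¹' (T \ {x})) ⊆ closure (closure (υ ⁻¹' (Z \ {x}))) := by
  intro hsub
  apply hTZ
  intro t ht
  by_contra htZ
  have htx : t ≠ x := fun h => htZ (h ▸ hxZ)
  have htW : t ∈ (⟨((vanishingIdeal ⟨{x}, hx⟩ : G.IdealSheafData).support : Set G)ᶜ,
      (vanishingIdeal ⟨{x}, hx⟩ : G.IdealSheafData).support.isClosed.isOpen_compl⟩ : G.Opens) := by
    show t ∈ ((vanishingIdeal ⟨{x}, hx⟩ : G.IdealSheafData).support : Set G)ᶜ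
    rw [Scheme.IdealSheafData.coe_support_vanishingIdeal]
    exact htx
  obtain ⟨t₂, ht₂, -⟩ := existsUnique_preimage υ hυ.isIso_compl htW
  have ht₂T : t₂ ∈ closure (υ ⁻¹' (T \ {x})) :=
    subset_closure (show υ t₂ ∈ T \ {x} by rw [ht₂]; exact ⟨ht, htx⟩)
  have h1 : t₂ ∈ closure (υ ⁻¹' (Z \ {x})) := by
    have := hsub ht₂T
    rwa [closure_closure] at this
  have h2 : υ t₂ ∈ closure (υ '' (υ ⁻¹' (Z \ {x}))) :=
    image_closure_subset_closure_image υ.continuous ⟨t₂, h1, rfl⟩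
  rw [ht₂] at h2
  exact htZ (closure_mono ((Set.image_preimage_subset _ _).trans fun _ h => h.1) h2)


/-! ## 2. Exactness (i): the special fibre of `(St 𝓢, St K)` is the pair of downstairs strict transforms — cone-pack form -/

/-- **F⁺5 for a cone pack.** Model square `j : F₁ → X'` over `Spec θ` (`O` a DVR, `ϖ` a uniformizer), `τ : X₁ → X'` the blow-up of
`J` with `J · 𝒪_{F₁} = 𝔪_x` (`x` closed), `υ : F₂ → F₁` the blow-up of the reduced point, `j₂ ≫ τ = υ ≫ j`. At `j x`: a frame `c`
of `J_{j x}` (`(c) + (ϖ) = 𝔪`, `ϖ ∉ (c)`, `𝒪/(c)` a domain, tail quasi-regular modulo `c₀`) with `𝓢_{j x} = (c₀)` and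
`K_{j x} = (Φ(c₁, …, c_r))`, `Φ` a form of degree `d`, `Φ ≢ 0 mod (c)` and `mod 𝔪`. Then
`(St_τ 𝓢 ⊔ St_τ K) · 𝒪_{F₂} = St_υ(𝓢 · 𝒪_{F₁}) ⊔ St_υ(K · 𝒪_{F₁})` — res-L1-w45b-stub-1's F⁺5 `comap_strictTransformIdeal_eq_of_model`
(p519966) for `𝓢` with the linear form `T₀` and for `K` with `Φ` renamed to the frame variables, the downstairs non-vanishing by
res-D-pv-029's `conePack_stalkMap_of_model` (p534965). [cite: GortzWedhorn2020, Prop. 13.91] [OURS · L1 W4.5b] brick (C) toward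
`stub_elnat_tcPlusPointResolution`; NOT a statement of the manuscript. -/
theorem comap_strictTransformIdeal_carrierPair_eq_sup_of_conePack (O : Type) [CommRing O] [IsDomain O]
    [IsDiscreteValuationRing O] (k : Type) [Field k] (θ : O →+* k) (hθ : Function.Surjective θ)
    {X' X₁ F₁ F₂ : Scheme.{0}} (r' : X' ⟶ Spec (.of O)) [IsLocallyNoetherian X₁] [IsLocallyNoetherian F₂] [IsIntegral F₁]
    [IsIntegral F₂] [IsLocallyNoetherian F₁] (j : F₁ ⟶ X') (t : F₁ ⟶ Spec (.of k))
    (hsq : IsPullback j t r' (Spec.map (CommRingCat.ofHom θ))) (J : X'.IdealSheafData)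
    (τ : X₁ ⟶ X') (hτ : IsBlowup τ J) (υ : F₂ ⟶ F₁) (j₂ : F₂ ⟶ X₁) (hcomm : j₂ ≫ τ = υ ≫ j)
    (x : F₁) (hx : IsClosed ({x} : Set F₁)) (hυ : IsBlowup υ (vanishingIdeal ⟨{x}, hx⟩))
    (hJ : J.comap j = vanishingIdeal ⟨{x}, hx⟩) (ϖ : O) (hϖ : Irreducible ϖ)
    {r : ℕ} (c : Fin (r + 1) → X'.presheaf.stalk (j x)) (hcJ : Ideal.span (Set.range c) = stalkIdeal J (j x))
    (hc : IsQuasiRegular c) [IsDomain (X'.presheaf.stalk (j x) ⧸ Ideal.span (Set.range c))]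
    (hcb : IsQuasiRegular fun l : Fin r => Ideal.Quotient.mk (Ideal.span {c 0}) (c l.succ))
    (hϖc : (X'.presheaf.Γgerm (j x)).hom (r'.appTop.hom ((Scheme.ΓSpecIso (.of O)).inv.hom ϖ)) ∉ Ideal.span (Set.range c))
    (h𝔪 : Ideal.span (Set.range c) ⊔
      Ideal.span {(X'.presheaf.Γgerm (j x)).hom (r'.appTop.hom ((Scheme.ΓSpecIso (.of O)).inv.hom ϖ))} =
        maximalIdeal (X'.presheaf.stalk (j x)))
    (𝓢 K : X'.IdealSheafData) (h𝓢 : stalkIdeal 𝓢 (j x) = Ideal.span {c 0})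
    {d : ℕ} (Φ : MvPolynomial (Fin r) (X'.presheaf.stalk (j x))) (hΦd : Φ.IsHomogeneous d)
    (hK : stalkIdeal K (j x) = Ideal.span {MvPolynomial.eval (fun l => c l.succ) Φ})
    (hΦ : MvPolynomial.map (Ideal.Quotient.mk (Ideal.span (Set.range c))) Φ ≠ 0)
    (hΦ𝔪 : MvPolynomial.map (residue (X'.presheaf.stalk (j x))) Φ ≠ 0) :
    (strictTransformIdeal τ J 𝓢 ⊔ strictTransformIdeal τ J K).comap j₂ =
      strictTransformIdeal υ (vanishingIdeal ⟨{x}, hx⟩) (𝓢.comap j) ⊔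
        strictTransformIdeal υ (vanishingIdeal ⟨{x}, hx⟩) (K.comap j) := by
  classical
  obtain ⟨hc𝔪d, hcq, -, -, -, hΦbar, -⟩ :=
    conePack_stalkMap_of_model O k θ hθ r' j t hsq x ϖ hϖ c hc hcb hϖc h𝔪 𝓢 K h𝓢 Φ hΦd hK hΦ𝔪
  haveI : Nontrivial (F₁.presheaf.stalk x ⧸ Ideal.span (Set.range fun i => (j.stalkMap x).hom (c i))) := by
    rw [hc𝔪d]; exact Ideal.Quotient.nontrivial_iff.mpr (maximalIdeal.isMaximal _).ne_top
  -- renaming a form in the tail variables to the frame variables keeps it non-zero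
  have hren : ∀ {R : Type} [CommRing R] (ψ : MvPolynomial (Fin r) R), ψ ≠ 0 → MvPolynomial.rename Fin.succ ψ ≠ 0 :=
    fun ψ hψ h => hψ (MvPolynomial.rename_injective _ (Fin.succ_injective _) (by rw [h, map_zero]))
  -- `𝓢`: the linear form `T₀`
  have e𝓢 := comap_strictTransformIdeal_eq_of_model τ J 𝓢 hτ j υ j₂ hcomm x hx hυ hJ c hcJ hc
    (MvPolynomial.X 0) (MvPolynomial.isHomogeneous_X _ 0) (by rw [MvPolynomial.map_X]; exact MvPolynomial.X_ne_zero _)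
    (by rw [MvPolynomial.eval_X]; exact h𝓢) hcq
    (by rw [MvPolynomial.map_X, MvPolynomial.map_X]; exact MvPolynomial.X_ne_zero _)
  -- `K`: the form `Φ` renamed to the frame variables
  have eK := comap_strictTransformIdeal_eq_of_model τ J K hτ j υ j₂ hcomm x hx hυ hJ c hcJ hc
    (MvPolynomial.rename Fin.succ Φ) hΦd.rename_isHomogeneous (by rw [MvPolynomial.map_rename]; exact hren _ hΦ)
    (by rw [MvPolynomial.eval_rename]; exact hK) hcq
    (by rw [MvPolynomial.map_rename, MvPolynomial.map_rename]; exact hren _ hΦbar)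
  rw [Scheme.IdealSheafData.comap_sup, e𝓢, eK]

/-! ## 3. The member after the blow-up of a CENTRED point -/

/-- **The in-carrier step at a centred point (Member level).** `O ↠ k` a DVR onto its residue field, `q : P → Spec O` proper and
smooth of relative dimension `3`, `P` integral regular, `Y` closed irreducible in the special fibre, `Ch` a stage predicate refining
`Split.Chain P Y` and closed under horizontal E1 steps. Let `TCPlus.Member O k θ P q Y Ch G T Z {x}` be a member CENTRED at the
closed point `x ∈ T` (`T ⊄ {x}`, `G` integral) and `υ : G₂ → G` the blow-up of the reduced point `x`. Then `G₂` is integral, the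
strict transform `closure υ⁻¹(T ∖ {x})` is irreducible, and `(St 𝓢, St K)` on the blow-up of the package's section is a member
`TCPlus.Member O k θ P q Y Ch G₂ (closure υ⁻¹(T ∖ {x})) (closure υ⁻¹(Z ∖ {x})) ∅` (see the module docstring for the bricks).
[cite: GortzWedhorn2020, Prop. 13.91, Prop. 13.96] [cite: Liu2002, Thm. 8.1.19] [OURS · L1 W4.5b] brick (C) toward
`stub_elnat_tcPlusPointResolution` (stmt-ResolutionOfSingularities-20148 / -20038); NOT a statement of the manuscript. -/
theorem member_strictTransform_of_centredPoint (O : Type) [CommRing O] [IsDomain O] [IsDiscreteValuationRing O]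
    (k : Type) [Field k] (θ : O →+* k) (hθ : Function.Surjective θ)
    (P : Scheme.{0}) [IsIntegral P] (q : P ⟶ Spec (.of O)) [IsProper q] [SmoothOfRelativeDimension 3 q]
    (Y : Set P) (hYsp : Y ⊆ q ⁻¹' {closedPoint O}) (hYirr : IsIrreducible Y) (hYcl : IsClosed Y)
    (hPnoeth : IsLocallyNoetherian P) (hPreg : Scheme.IsRegular P)
    (Ch : ∀ X' : Scheme.{0}, (X' ⟶ P) → Set X' → Prop)
    (hChain : ∀ (X' : Scheme.{0}) (σ : X' ⟶ P) (S : Set X'), Ch X' σ S → Chain P Y X' σ S)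
    (hStep : ∀ (X' X'' : Scheme.{0}) (σ' : X' ⟶ P) (S' : Set X') (C : X'.IdealSheafData) (τ : X'' ⟶ X'),
      Ch X' σ' S' → IsBlowup τ C → Scheme.IsRegular C.subscheme → Flat (C.subschemeι ≫ σ' ≫ q) →
      σ' '' (C.support : Set X') ⊆ {x : P | ¬ IsGenericPoint x Y} →
      (C.support : Set X') ∩ (σ' ≫ q) ⁻¹' {closedPoint O} ⊆ S' →
      Ch X'' (τ ≫ σ') (closure (τ ⁻¹' (S' \ (C.support : Set X')))))
    (G : Scheme.{0}) [IsIntegral G] (T Z : Set G) (x : G) (hx : IsClosed ({x} : Set G)) (hxT : x ∈ T) (hTx : ¬ T ⊆ {x})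
    (hmem : TCPlus.Member O k θ P q Y Ch G T Z {x})
    (G₂ : Scheme.{0}) (υ : G₂ ⟶ G) (hυ : IsBlowup υ (vanishingIdeal ⟨{x}, hx⟩)) :
    IsIntegral G₂ ∧ IsIrreducible (closure (υ ⁻¹' (T \ {x}))) ∧
      TCPlus.Member O k θ P q Y Ch G₂ (closure (υ ⁻¹' (T \ {x}))) (closure (υ ⁻¹' (Z \ {x}))) ∅ := by
  classical
  obtain ⟨X, σ, S, j, t, 𝓢, K, hCh, hXint, hXnoeth, hXreg, hdom, hsq, hTS, hi, hii, hiii₁, hiii₂, hiv, hv, hvi⟩ := hmem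
  haveI := hXint
  haveI := hXnoeth
  obtain ⟨s, hs, hsx, hle, c, m, Φ, hcJ, hc, hdomc, hcb, h𝓢, -, hΦm, hK, hΦc, hΦ𝔪, hΔ⟩ := hvi x (Set.mem_singleton x)
  haveI := hdomc
  -- the stage is proper over `Spec O`
  obtain ⟨-, -, hσ⟩ := chain_isRegular P Y X σ S (hChain _ _ _ hCh) hPnoeth hPreg
  haveI := hσ
  haveI : IsProper (σ ≫ q) := inferInstance
  -- the model square: `j` is a closed immersion onto the special fibre
  haveI : IsClosedImmersion (Spec.map (CommRingCat.ofHom θ)) := IsClosedImmersion.spec_of_surjective _ hθ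
  haveI hjci : IsClosedImmersion j := MorphismProperty.IsStableUnderBaseChange.of_isPullback hsq.flip inferInstance
  haveI : IsLocallyNoetherian G := LocallyOfFiniteType.isLocallyNoetherian j
  have hrangej : Set.range j = (σ ≫ q) ⁻¹' {closedPoint O} := by
    rw [range_eq_preimage_of_isPullback hsq, range_specMap_of_surjective_of_field θ hθ]
  have hjxsp : (σ ≫ q) (j x) = closedPoint O := by
    have h : j x ∈ Set.range j := ⟨x, rfl⟩
    rw [hrangej] at h
    exact h
  have hjxcl : IsClosed ({j x} : Set X) := by
    rw [← Set.image_singleton]; exact hjci.isClosedEmbedding.isClosedMap _ hx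
  have hrs : ∀ p' : Spec (.of O), (σ ≫ q) (s p') = p' := fun p' => by
    rw [← Scheme.Hom.comp_apply, hs]; rfl
  -- the centre `ker s` and the stepped point `j x = s(𝔪_O)`
  obtain ⟨_, -, -, hCsupp⟩ := section_isClosedImmersion_and_isRegular_ker O X (σ ≫ q) s hs
  have hpC : j x ∈ (s.ker.support : Set X) := by rw [hCsupp, ← hsx]; exact ⟨_, rfl⟩
  have hpD : j x ∈ ((𝓢 ⊔ K).support : Set X) := Scheme.IdealSheafData.support_antitone hle hpC
  have hw : ¬ IsGenericPoint (σ (j x)) Y := hiv ⟨j x, hpD, rfl⟩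
  -- blow the section up; the model point step (res-D-pv-029, K3″)
  obtain ⟨X₂, τ, hτ⟩ := exists_isBlowup X s.ker
  obtain ⟨hCh₂, hreg₂, hnoeth₂, hint₂, hdom₂, hG₂int, hT₂irr, hJ, -, -, -, j₂, t₂, hsq₂, hcomm, -, hsets⟩ :=
    modelPointStep_of_section O k θ hθ P q Y hYsp hYirr hYcl Ch hChain hStep X σ S hCh hXreg hdom G j t hsq T hTS x hx hxT
      hTx hw s hs hsx X₂ τ hτ G₂ υ hυ
  haveI := hnoeth₂
  haveI := hG₂int
  haveI hj₂ci : IsClosedImmersion j₂ := MorphismProperty.IsStableUnderBaseChange.of_isPullback hsq₂.flip inferInstance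
  haveI : IsLocallyNoetherian G₂ := LocallyOfFiniteType.isLocallyNoetherian j₂
  -- a uniformizer; the section-frame identities hold for the package frame (same ideal `(ker s)_{j x}`)
  obtain ⟨ϖ, hϖ⟩ := IsDiscreteValuationRing.exists_irreducible O
  obtain ⟨n', c', -, hc'J, -, -, -, h𝔪', hϖc', -⟩ :=
    exists_sectionFrame_forall_dim_at O (σ ≫ q) s hs (j x) hsx (hXreg (j x)) ϖ hϖ
  have h𝔪 : Ideal.span (Set.range c) ⊔
      Ideal.span {(X.presheaf.Γgerm (j x)).hom ((σ ≫ q).appTop.hom ((Scheme.ΓSpecIso (.of O)).inv.hom ϖ))} =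
        maximalIdeal (X.presheaf.stalk (j x)) := by
    rw [hcJ, ← hc'J]; exact h𝔪'
  have hϖc : (X.presheaf.Γgerm (j x)).hom ((σ ≫ q).appTop.hom ((Scheme.ΓSpecIso (.of O)).inv.hom ϖ)) ∉
      Ideal.span (Set.range c) := by
    rw [hcJ, ← hc'J]; exact hϖc'
  -- `dim 𝒪_{X, j x} = 3 + 1` (T-DIM)
  have hdim : ringKrullDim (X.presheaf.stalk (j x)) = (2 + 2 : ℕ) :=
    ringKrullDim_stalk_eq_succ_of_chain q 3 (hYirr.isGenericPoint_genericPoint hYcl) (hChain _ _ _ hCh) hjxcl hjxsp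
  -- supports: `supp (St 𝓢 ⊔ St K) ⊆ τ⁻¹ supp (𝓢 ⊔ K)`
  have hStsub : ∀ I : X.IdealSheafData,
      ((strictTransformIdeal τ s.ker I).support : Set X₂) ⊆ τ ⁻¹' (I.support : Set X) := fun I =>
    (support_strictTransformIdeal_subset τ s.ker I).trans
      (closure_minimal (Set.preimage_mono fun _ h => h.1) (I.support.isClosed.preimage τ.continuous))
  have hsuppτ : ∀ z ∈ ((strictTransformIdeal τ s.ker 𝓢 ⊔ strictTransformIdeal τ s.ker K).support : Set X₂),
      τ z ∈ ((𝓢 ⊔ K).support : Set X) := by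
    intro z hz
    have h1 : τ z ∈ (𝓢.support : Set X) := hStsub 𝓢 (Scheme.IdealSheafData.support_antitone le_sup_left hz)
    have h2 : τ z ∈ (K.support : Set X) := hStsub K (Scheme.IdealSheafData.support_antitone le_sup_right hz)
    rw [Scheme.IdealSheafData.support_sup, Closeds.coe_inf]
    exact ⟨h1, h2⟩
  -- (iii) regular carrier, locally principal pair: K7d (the carrier is non-zero: `c₀ ≠ 0` by quasi-regularity)
  have hItop : Ideal.span (Set.range c) ≠ ⊤ := fun h =>
    not_subsingleton (X.presheaf.stalk (j x) ⧸ Ideal.span (Set.range c)) (Ideal.Quotient.subsingleton_iff.mpr h)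
  have hc0 : c 0 ≠ 0 := by
    intro h0
    have hmem := (isQuasiRegular_def c).mp hc 1 (MvPolynomial.X 0) (MvPolynomial.isHomogeneous_X _ 0)
      (by rw [MvPolynomial.eval_X, h0]; exact Ideal.zero_mem _) (Finsupp.single 0 1)
    simp only [MvPolynomial.coeff_X, if_true] at hmem
    exact hItop ((Ideal.eq_top_iff_one _).mpr hmem)
  have h𝓢0 : 𝓢 ≠ ⊥ := by
    intro h
    apply hc0
    have h' : stalkIdeal 𝓢 (j x) = ⊥ := by rw [h]; exact stalkIdeal_bot _
    rw [h𝓢, Ideal.span_singleton_eq_bot] at h'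
    exact h'
  obtain ⟨⟨hiii₁', hiii₂'⟩, -⟩ :=
    member_clause_iii_strictTransform_section O (σ ≫ q) s hs hXreg hτ 𝓢 K hle h𝓢0 ⟨hiii₁, hiii₂⟩
  refine ⟨hG₂int, hT₂irr, X₂, τ ≫ σ, closure (τ ⁻¹' (S \ (s.ker.support : Set X))), j₂, t₂,
    strictTransformIdeal τ s.ker 𝓢, strictTransformIdeal τ s.ker K, hCh₂, hint₂, hnoeth₂, hreg₂, hdom₂, hsq₂, hsets,
    ?_, ?_, hiii₁', hiii₂', ?_, ?_, ?_⟩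
  · -- (i) exact special fibre: F⁺5 for the cone pack, then K7e downstairs
    rw [comap_strictTransformIdeal_carrierPair_eq_sup_of_conePack O k θ hθ (σ ≫ q) j t hsq s.ker τ hτ υ j₂ hcomm x hx hυ hJ
        ϖ hϖ c hcJ hc hcb hϖc h𝔪 𝓢 K h𝓢 Φ hΦm hK hΦc hΦ𝔪,
      strictTransformIdeal_comap_sup_eq_vanishingIdeal_of_centredPackage O k θ hθ (σ ≫ q) j t hsq x hx υ hυ ϖ hϖ c hc hcb
        hϖc h𝔪 𝓢 K h𝓢 Φ hΦm hK hΦ𝔪 Z hi]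
    congr 1
    exact Closeds.ext closure_closure.symm
  · -- (ii) flat over `O`: K7b with the package frame
    exact flat_carrierStrictTransform_subschemeι_comp_at O σ q s hs τ hτ 𝓢 K hii (j x) hsx c hcJ h𝓢 Φ hΦm hK ϖ hϖ h𝔪
      hdim hΦ𝔪
  · -- (iv) off the generic point of `Y`
    rintro _ ⟨z, hz, rfl⟩
    rw [Scheme.Hom.comp_apply]
    exact hiv ⟨τ z, hsuppτ z hz, rfl⟩
  · -- (v) regular quotient stalks of codimension two at the special points
    intro z hz hzs _
    have hzs' : (σ ≫ q) (τ z) = closedPoint O := by simpa only [Scheme.Hom.comp_apply] using hzs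
    by_cases hzp : τ z = j x
    · -- over the stepped point: the Δ-package
      have key := isRegularLocalRing_quotient_carrierStrictTransform_of_coneDeltaRegular_at hτ 𝓢 K (j x) z hzp hpC c hcJ hc
        hcb h𝓢 Φ hΦm hΦc hK hz hΔ
      exact ⟨key.1, fun _ => key.2⟩
    · -- off the stepped point: `τ` is an isomorphism there and the old member's clause (v) applies
      have hzC : τ z ∉ (s.ker.support : Set X) := by
        rw [hCsupp]
        rintro ⟨p', hp'⟩
        have hp's : p' = closedPoint O := by rw [← hrs p', hp']; exact hzs'
        exact hzp (by rw [← hp', hp's, hsx])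
      have hτz : τ z ∉ j '' {x} := by rw [Set.image_singleton]; exact hzp
      obtain ⟨hreg₀, hcod₀⟩ := hv (τ z) (hsuppτ z hz) hzs' hτz
      obtain ⟨hreg₁, hdim₁⟩ := isRegularLocalRing_quotient_carrierStrictTransform_of_not_mem_support hτ 𝓢 K hzC hreg₀
      refine ⟨hreg₁, fun hzcl => ?_⟩
      haveI : IsProper τ := hτ.isProper
      have hτzcl : IsClosed ({τ z} : Set X) := by rw [← Set.image_singleton]; exact τ.isClosedMap _ hzcl
      rw [hdim₁, ringKrullDim_stalk_eq_of_not_mem_support hτ hzC]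
      exact hcod₀ hτzcl
  · -- (vi) no excluded point
    simp

/-! ## 4. `inv_step_singular` -/

/-- **(step, flag raised) for `TCPlus.Inv` at `n = 3`.** The third hypothesis of the driver `hsub_reachTCPlus_of_invariant`
(p526242) for `INV := TCPlus.Inv O k θ P q Y Ch`: from `Inv W G₁ β T Z false`, a closed NON-REGULAR point `y` of the reduced curve
`V(closure Z)_red` on `T` and the blow-up `υ₁` of the reduced point, the invariant holds with the flag raised for
`(G₂, υ₁ ≫ β, closure υ₁⁻¹(T ∖ {y}), closure υ₁⁻¹(Z ∖ {y}))` — the flag clause of `Inv` supplies the member centred at `y`,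
`member_strictTransform_of_centredPoint` steps it, and `T ⊄ closure Z` persists because `υ₁` is onto off `y`.
(The downstairs regularity of `G₁` at `y` is part of the driver's interface and is not used: the section is given by the package.)
[cite: GortzWedhorn2020, Prop. 13.91, Prop. 13.96] [cite: Liu2002, Thm. 8.1.19] [OURS · L1 W4.5b] brick (C) of the HSUB(ReachTC⁺)₃ assembly
toward `stub_elnat_tcPlusPointResolution` (stmt-ResolutionOfSingularities-20148 / -20038); NOT a statement of the manuscript. -/
theorem inv_step_singular (O : Type) [CommRing O] [IsDomain O] [IsDiscreteValuationRing O]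
    (k : Type) [Field k] (θ : O →+* k) (hθ : Function.Surjective θ)
    (P : Scheme.{0}) [IsIntegral P] (q : P ⟶ Spec (.of O)) [IsProper q] [SmoothOfRelativeDimension 3 q]
    (Y : Set P) (hYsp : Y ⊆ q ⁻¹' {closedPoint O}) (hYirr : IsIrreducible Y) (hYcl : IsClosed Y)
    (hPnoeth : IsLocallyNoetherian P) (hPreg : Scheme.IsRegular P)
    (Ch : ∀ X' : Scheme.{0}, (X' ⟶ P) → Set X' → Prop)
    (hChain : ∀ (X' : Scheme.{0}) (σ : X' ⟶ P) (S : Set X'), Ch X' σ S → Chain P Y X' σ S)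
    (hStep : ∀ (X' X'' : Scheme.{0}) (σ' : X' ⟶ P) (S' : Set X') (C : X'.IdealSheafData) (τ : X'' ⟶ X'),
      Ch X' σ' S' → IsBlowup τ C → Scheme.IsRegular C.subscheme → Flat (C.subschemeι ≫ σ' ≫ q) →
      σ' '' (C.support : Set X') ⊆ {x : P | ¬ IsGenericPoint x Y} →
      (C.support : Set X') ∩ (σ' ≫ q) ⁻¹' {closedPoint O} ⊆ S' →
      Ch X'' (τ ≫ σ') (closure (τ ⁻¹' (S' \ (C.support : Set X')))))
    {F₁ F₂ : Scheme.{0}} (W : Set F₁) (G₁ G₂ : Scheme.{0}) (β : G₁ ⟶ F₂) (T Z : Set G₁)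
    (y : ↥((vanishingIdeal (⟨closure Z, isClosed_closure⟩ : Closeds G₁))).subscheme) (υ₁ : G₂ ⟶ G₁)
    (hy : IsClosed ({((vanishingIdeal (⟨closure Z, isClosed_closure⟩ : Closeds G₁)).subschemeι y : G₁)} : Set G₁))
    (hInv : TCPlus.Inv O k θ P q Y Ch W G₁ β T Z false)
    (hyT : ((vanishingIdeal (⟨closure Z, isClosed_closure⟩ : Closeds G₁)).subschemeι y : G₁) ∈ T)
    (hysing : ¬ IsRegularLocalRing
      (((vanishingIdeal (⟨closure Z, isClosed_closure⟩ : Closeds G₁))).subscheme.presheaf.stalk y))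
    (_hyreg : IsRegularLocalRing
      (G₁.presheaf.stalk ((vanishingIdeal (⟨closure Z, isClosed_closure⟩ : Closeds G₁)).subschemeι y)))
    (hυ₁ : IsBlowup υ₁ (vanishingIdeal
      ⟨{((vanishingIdeal (⟨closure Z, isClosed_closure⟩ : Closeds G₁)).subschemeι y : G₁)}, hy⟩)) :
    TCPlus.Inv O k θ P q Y Ch W G₂ (υ₁ ≫ β)
      (closure (υ₁ ⁻¹' (T \ {((vanishingIdeal (⟨closure Z, isClosed_closure⟩ : Closeds G₁)).subschemeι y : G₁)})))
      (closure (υ₁ ⁻¹' (Z \ {((vanishingIdeal (⟨closure Z, isClosed_closure⟩ : Closeds G₁)).subschemeι y : G₁)})))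
      true := by
  obtain ⟨hGint, -, -, hTZ, -, hflag⟩ := hInv
  haveI := hGint
  have hmem := hflag rfl y hy hysing
  have hxZ : ((vanishingIdeal (⟨closure Z, isClosed_closure⟩ : Closeds G₁)).subschemeι y : G₁) ∈ closure Z := by
    have h : ((vanishingIdeal (⟨closure Z, isClosed_closure⟩ : Closeds G₁)).subschemeι y : G₁) ∈
        Set.range (vanishingIdeal (⟨closure Z, isClosed_closure⟩ : Closeds G₁)).subschemeι := ⟨y, rfl⟩
    rw [Scheme.IdealSheafData.range_subschemeι, Scheme.IdealSheafData.coe_support_vanishingIdeal] at h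
    exact h
  have hTx : ¬ T ⊆ {((vanishingIdeal (⟨closure Z, isClosed_closure⟩ : Closeds G₁)).subschemeι y : G₁)} := fun h =>
    hTZ (h.trans (Set.singleton_subset_iff.mpr hxZ))
  obtain ⟨hG₂int, hT₂irr, hmem₂⟩ := member_strictTransform_of_centredPoint O k θ hθ P q Y hYsp hYirr hYcl hPnoeth hPreg Ch
    hChain hStep G₁ T Z _ hy hyT hTx hmem G₂ υ₁ hυ₁
  exact ⟨hG₂int, isClosed_closure, hT₂irr, not_closure_preimage_diff_subset_of_isBlowup_point υ₁ hy hυ₁ hTZ hxZ, hmem₂,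
    fun h => Bool.noConfusion h⟩

end Summit.ResolutionOfSingularities.ResolutionOfSingularities.Cruxes.EquisingularLiftNat.Sections

end
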